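import Mathlib
import HarnessLib
import Literature.MathematicalPhysics.StatisticalMechanics.FlowStepTorus
import Literature.MathematicalPhysics.StatisticalMechanics.FlowWeightIntegrability

/-!
# The iterated representation `∫ (e^{−H_0} ∘_0 K_0)(Λ) dμ^{(q)} = 1 + ∫ K_N(Λ) dμ_{N+1}` along a
# renormalisation-group trajectory for the torus data, and `|∫ K_N(Λ) dμ_{N+1}| ≤ ‖K_N‖ A_𝒫/A`
# ([ABKM19] Ch. 4.2–4.4, (4.9)–(4.12))

Let `(H_k, K_k)_{k ≤ N}` be a trajectory of the renormalisation group for the torus data — relevant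
Hamiltonians with `‖H_k‖_{k,0} ≤ ⅛`, factorising activities with `K_k(∅) = 1`, `C^{r₀}`, local, of weak
norm `‖K_k‖_k^{(A)} ≤ C_k`, related by `H_{k+1} = nextH(H_k, K_k)` and `K_{k+1} = S(H_k, K_k)` on
`(k+1)`-polymers — for a family of step kernels `𝒞s` with `StepKernelBounds` at every scale (the
tuned Gaussian `μ^{(q)}` of Ch. 12).  Then, with `F_k = (e^{−H_k} ∘_k K_k)(Λ)`:

* **`integral_flow_eq_abkm`** — `∫ F_0 d(μ_1 ∗ ⋯ ∗ μ_{N+1}) = ∫ F_N dμ_{N+1}` (Proposition 6.6 at every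
  step, `FlowStepTorus.integral_pcirc_step_abkm`, and Fubini from the weight bound
  `|F_k| ≤ C w_k^Λ` with `FlowWeightIntegrability`);
* `numBlocks_top_univ`, `isConn_top_univ` — at the last scale `Λ` is one connected block;
* **`norm_integral_last_le_abkm`** — `|∫ K_N(Λ) dμ_{N+1}| ≤ C_N · A⁻¹ · A_𝒫` (weak norm on the single
  `N`-block, (w7) at `φ = 0`);
* **`integral_flow_repr_abkm`** — if moreover `H_N = 0`: `∫ F_0 d(μ_1 ∗ ⋯ ∗ μ_{N+1}) = 1 + ∫ K_N(Λ) dμ_{N+1}`.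

Everything is proved; no named fact.  Not here: the tuned trajectory itself (Lemma 12.6,
`exists_tuned_initial_iota_of_torusFRD` in the crux's Theorems) and its identification with such a
sequence.

## References
* S. Adams, S. Buchholz, R. Kotecký, S. Müller, arXiv:1910.13564, Ch. 4.2–4.4 (4.9)–(4.12),
  Proposition 6.6 [AdamsBuchholzKoteckyMuller2019].
-/

noncomputable section

namespace Literature.MathematicalPhysics.StatisticalMechanics.GradientRG

open scoped BigOperators Classical
open Finset Matrix MeasureTheory
open Literature.MathematicalPhysics.StatisticalMechanics.TorusPolymer
  (IsPolymer Separated blocks polys bprod pcirc blockOf thicken numBlocks mem_polys mem_blocks isPolymer_blockOf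
    isPolymer_empty isPolymer_univ blockOf_eq_univ)
open Literature.Barriers.CriticalPhenomena.LongRangePhi4.Polymer (IsConn components)
open Literature.MathematicalPhysics.QuantumFieldTheory

variable {d M : ℕ} [NeZero M]

/-! ## The last scale: `Λ` is a single connected block -/

/-- At block side `M` the torus is one block: `𝓑_N(Λ) = {Λ}`. [cite: AdamsBuchholzKoteckyMuller2019, Ch. 4.3] -/
theorem blocks_top_univ (hM : Odd M) (hne : (univ : Finset (Fin d → ZMod M)).Nonempty) :
    blocks M (univ : Finset (Fin d → ZMod M)) = {univ} := by
  unfold TorusPolymer.blocks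
  rw [Finset.image_congr (g := fun _ => univ) (fun x _ => blockOf_eq_univ hM x)]
  exact Finset.image_const hne _

/-- `|Λ|_N = 1`. [cite: AdamsBuchholzKoteckyMuller2019, Ch. 4.3] -/
theorem numBlocks_top_univ (hM : Odd M) (hne : (univ : Finset (Fin d → ZMod M)).Nonempty) :
    numBlocks M (univ : Finset (Fin d → ZMod M)) = 1 := by
  rw [← TorusPolymer.card_blocks_eq_numBlocks, blocks_top_univ hM hne, Finset.card_singleton]

/-- `Λ` is connected at the last scale. [cite: AdamsBuchholzKoteckyMuller2019, Ch. 4.3] -/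
theorem isConn_top_univ (hM : Odd M) : IsConn (univ : Finset (Fin d → ZMod M)) := by
  have h := TorusPolymer.isConn_blockOf hM hM (0 : Fin d → ZMod M)
  rwa [blockOf_eq_univ hM] at h

/-! ## The iterated identity along a trajectory -/

section Flow

variable {L N Mord R n p r₀ : ℕ} {θbar lam μ δ₁ δ₀ A𝒫 A𝒫' C₂ h A : ℝ}
  {𝒞 𝒞s : ℕ → (Fin d → ZMod M) → ℝ}
  {H : ℕ → RelevantHamiltonian ℂ d} {K : ℕ → Finset (Fin d → ZMod M) → ((Fin d → ZMod M) → ℝ) → ℂ}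
  {C : ℕ → ℝ}

/-- **`∫ F_0 d(μ_1 ∗ ⋯ ∗ μ_{N+1}) = ∫ F_N dμ_{N+1}`** along a trajectory of the renormalisation group for
the torus data (module docstring). [cite: AdamsBuchholzKoteckyMuller2019, Ch. 4.2 (4.11)–(4.12)] -/
theorem integral_flow_eq_abkm (hd : 3 ≤ d) (hLodd : Odd L)
    (hM : M = L ^ N) (hp : d / 2 + 1 ≤ p) (hMord : d / 2 + 1 ≤ Mord)
    (hB : AbkmWeightBounds L N Mord R n θbar lam μ δ₁ δ₀ A𝒫 𝒞
      (abkmWeightData L N Mord R θbar (schedDelta δ₀ δ₁ N) 𝒞))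
    (hS : ∀ k, k ≤ N → StepKernelBounds (abkmWeightData L N Mord R θbar (schedDelta δ₀ δ₁ N) 𝒞) L k A𝒫' C₂ (𝒞s (k + 1)))
    (hδ₀ : 0 < δ₀) (hδ₁ : 0 < δ₁) (hh : 0 < h) (hh0 : hZeroSq d R δ₀ δ₁ ≤ h ^ 2) (hA : 0 < A)
    (hH : ∀ k, k ≤ N → hamNorm (fieldWt h (L : ℝ) d k) ((L : ℝ) ^ k) (L ^ (d * k)) (H k) ≤ 1 / 8)
    (hC : ∀ k, 0 ≤ C k)
    (hK : ∀ k, k ≤ N → WeakNormLE (abkmNormParams L N Mord R p r₀ h θbar A (schedDelta δ₀ δ₁ N) 𝒞) k (K k) (C k))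
    (hKfac : ∀ k, k ≤ N → Factorises (L ^ k) (K k)) (hK0 : ∀ k φ, K k ∅ φ = 1)
    (hKd : ∀ k Y, ContDiff ℝ r₀ (K k Y))
    (hKloc : ∀ k, k ≤ N → ∀ Y, IsPolymer (L ^ k) Y → IsConn Y →
      IsGaugeLocal ((abkmNormParams L N Mord R p r₀ h θbar A (schedDelta δ₀ δ₁ N) 𝒞).gauge k Y) (K k Y))
    (hHs : ∀ k, k < N → H (k + 1) = nextH (abkmStepData L R k 𝒞s) (H k) (K k))
    (hKs : ∀ k, k < N → ∀ U, IsPolymer (L ^ (k + 1)) U → ∀ φ,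
      K (k + 1) U φ = nextKStep (abkmStepData L R k 𝒞s) (H k) (K k) U φ) :
    ∫ φ, pcirc (L ^ 0) (fun V => expNegH (H 0) V φ) (fun U => K 0 U φ) univ ∂(tailMeasure 𝒞s N N) =
      ∫ φ, pcirc (L ^ N) (fun V => expNegH (H N) V φ) (fun U => K N U φ) univ ∂(tailMeasure 𝒞s N 0) := by
  have hd2 : 2 ≤ d := by omega
  -- the strong family only enters through `X ⊆ X*`
  have hGs := hB.strong (diffIndex d Mord) (fun α hα => hα) (strongCoef h N) (strongCoef_le hδ₀ hδ₁ hh hh0)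
  have hsub : ∀ k X, X ⊆ (abkmWeightData L N Mord R θbar (schedDelta δ₀ δ₁ N) 𝒞).enl k X := hGs.subset_enl
  have h𝒞 : ∀ j, 1 ≤ j → j ≤ N + 1 → (Matrix.circulant (𝒞s j)).PosSemidef := by
    intro j hj hjN
    obtain ⟨k, rfl⟩ : ∃ k, j = k + 1 := ⟨j - 1, by omega⟩
    exact (hS k (by omega)).posSemidef
  have hKcont : ∀ k Y, Continuous (K k Y) := fun k Y => (hKd k Y).continuous
  have hKmeas : ∀ k Y, Measurable (K k Y) := fun k Y => (hKcont k Y).measurable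
  refine integral_flow_eq h𝒞 (F := fun k φ => pcirc (L ^ k) (fun V => expNegH (H k) V φ) (fun U => K k U φ) univ)
    (fun k _ => (continuous_pcirc_expNegH (L ^ k) (H k) (hKcont k)).measurable) ?_ ?_
  · -- one step: Proposition 6.6 and the recursion
    intro k hk φ
    rw [integral_pcirc_step_abkm (p := p) (r₀ := r₀) hd2 hLodd hM hk.le hp hMord hB (hS k hk.le) hδ₀ hδ₁ hh hh0 hA
      (hH k hk.le) (hC k) (hK k hk.le) (hKfac k hk.le) (hK0 k) (hKd k) (hKloc k hk.le) φ,
      TorusPolymer.pcirc_comm _ _ (isPolymer_univ (L ^ (k + 1)))]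
    refine (TorusPolymer.pcirc_congr_left _ fun V _ _ => ?_).trans
      (TorusPolymer.pcirc_congr_right _ (isPolymer_univ _) fun U hU _ => ?_)
    · rw [hHs k hk]
    · exact (hKs k hk U hU φ).symm
  · -- Fubini: `|F_k| ≤ C w_k^Λ`
    intro k hk
    exact integrable_prod_of_norm_le_weight hB.dominated hB.monotone hsub hS hk
      (continuous_pcirc_expNegH (L ^ k) (H k) (hKcont k))
      (norm_pcirc_expNegH_mul_le_weight_abkm (p := p) (r₀ := r₀) hd2 hLodd hM hk.le hp hMord hB hδ₀ hδ₁ hh hh0 hA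
        (hH k hk.le) (hC k) (hK k hk.le) (hKfac k hk.le) (hK0 k) (hKd k) (hKloc k hk.le))

/-- **`|∫ K_N(Λ) dμ_{N+1}| ≤ C_N · A⁻¹ · A_𝒫`** for an admissible `N`-activity of weak norm `≤ C_N`
(`Λ` is one connected `N`-block; (w7) at `φ = 0`, where `w_{N:N+1}^Λ(0) = 1`).
[cite: AdamsBuchholzKoteckyMuller2019, Ch. 4.4 (∫|K_N| ≤ ‖K_N‖)] -/
theorem norm_integral_last_le_abkm (hLodd : Odd L) (hM : M = L ^ N)
    (hB : AbkmWeightBounds L N Mord R n θbar lam μ δ₁ δ₀ A𝒫 𝒞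
      (abkmWeightData L N Mord R θbar (schedDelta δ₀ δ₁ N) 𝒞))
    (hSN : StepKernelBounds (abkmWeightData L N Mord R θbar (schedDelta δ₀ δ₁ N) 𝒞) L N A𝒫' C₂ (𝒞s (N + 1)))
    (hA : 0 < A)
    {KN : Finset (Fin d → ZMod M) → ((Fin d → ZMod M) → ℝ) → ℂ} {CN : ℝ} (hCN : 0 ≤ CN)
    (hKN : WeakNormLE (abkmNormParams L N Mord R p r₀ h θbar A (schedDelta δ₀ δ₁ N) 𝒞) N KN CN)
    (hKNloc : ∀ Y, IsPolymer (L ^ N) Y → IsConn Y →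
      IsGaugeLocal ((abkmNormParams L N Mord R p r₀ h θbar A (schedDelta δ₀ δ₁ N) 𝒞).gauge N Y) (KN Y)) :
    ‖∫ φ, KN univ φ ∂(stepMeasure (𝒞s (N + 1)))‖ ≤ CN * A⁻¹ * A𝒫' := by
  set P := abkmNormParams L N Mord R p r₀ h θbar A (schedDelta δ₀ δ₁ N) 𝒞 with hP
  set W := abkmWeightData L N Mord R θbar (schedDelta δ₀ δ₁ N) 𝒞 with hW
  have hMo : Odd M := by rw [hM]; exact hLodd.pow
  have hne : (univ : Finset (Fin d → ZMod M)).Nonempty := Finset.univ_nonempty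
  have hLN : L ^ N = M := hM.symm
  have hΛp : IsPolymer (L ^ N) (univ : Finset (Fin d → ZMod M)) := isPolymer_univ _
  have hΛc : IsConn (univ : Finset (Fin d → ZMod M)) := isConn_top_univ hMo
  have hnb : numBlocks (L ^ N) (univ : Finset (Fin d → ZMod M)) = 1 := by
    rw [hLN]; exact numBlocks_top_univ hMo hne
  have haF : P.aFactor N univ = A⁻¹ := by
    unfold NormParams.aFactor
    rw [abkmNormParams_A, abkmNormParams_L, hnb, pow_one]
  -- pointwise: `|K_N(Λ, ψ)| ≤ C_N A⁻¹ w_N^Λ(ψ)`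
  have hb : TayNormLE (P.gauge N univ) r₀ (W.weight N univ) (KN univ) (CN * P.aFactor N univ) := hKN univ hΛp hΛc
  have hpt : ∀ ψ, ‖KN univ ψ‖ ≤ CN * A⁻¹ * W.weight N univ ψ := fun ψ => by
    have h1 := norm_apply_le_tayNorm r₀ (hKNloc univ hΛp hΛc) ψ
    have h2 := hb ψ
    rw [haF] at h2
    exact h1.trans (by simpa [hP] using h2)
  -- integrate: (w7) at `φ = 0`
  have hint : Integrable (fun ξ : (Fin d → ZMod M) → ℝ => W.weight N univ ((0 : (Fin d → ZMod M) → ℝ) + ξ))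
      (stepMeasure (𝒞s (N + 1))) := hSN.integrable_weight hB.dominated univ 0
  have hmid : W.midWeight N univ 0 = 1 := by
    simp [WeightData.midWeight]
  have hw7 : ∫ ξ, W.weight N univ ((0 : (Fin d → ZMod M) → ℝ) + ξ) ∂(stepMeasure (𝒞s (N + 1))) ≤ A𝒫' := by
    have h := hSN.integral_stepMeasure_le hΛp 0
    rwa [hnb, pow_one, hmid, mul_one] at h
  calc ‖∫ φ, KN univ φ ∂(stepMeasure (𝒞s (N + 1)))‖
      ≤ ∫ φ, ‖KN univ φ‖ ∂(stepMeasure (𝒞s (N + 1))) := norm_integral_le_integral_norm _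
    _ ≤ ∫ φ, CN * A⁻¹ * W.weight N univ ((0 : (Fin d → ZMod M) → ℝ) + φ) ∂(stepMeasure (𝒞s (N + 1))) := by
        refine integral_mono_of_nonneg (ae_of_all _ fun φ => norm_nonneg _) (hint.const_mul _)
          (ae_of_all _ fun φ => ?_)
        simpa using hpt φ
    _ = CN * A⁻¹ * ∫ φ, W.weight N univ ((0 : (Fin d → ZMod M) → ℝ) + φ) ∂(stepMeasure (𝒞s (N + 1))) :=
        integral_const_mul _ _
    _ ≤ CN * A⁻¹ * A𝒫' := mul_le_mul_of_nonneg_left hw7 (mul_nonneg hCN (inv_pos.2 hA).le)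

/-- **The representation at the last scale**: with `H_N = 0` and `K_N(∅) = 1`,
`∫ (e^{−H_N} ∘_N K_N)(Λ) dμ_{N+1} = 1 + ∫ K_N(Λ) dμ_{N+1}` (integrability from the weak norm).
[cite: AdamsBuchholzKoteckyMuller2019, Ch. 4.4 (𝒵 = ∫(1+K_N)dμ)] -/
theorem integral_last_scale_abkm (hLodd : Odd L) (hM : M = L ^ N)
    (hB : AbkmWeightBounds L N Mord R n θbar lam μ δ₁ δ₀ A𝒫 𝒞
      (abkmWeightData L N Mord R θbar (schedDelta δ₀ δ₁ N) 𝒞))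
    (hSN : StepKernelBounds (abkmWeightData L N Mord R θbar (schedDelta δ₀ δ₁ N) 𝒞) L N A𝒫' C₂ (𝒞s (N + 1)))
    (hA : 0 < A)
    {KN : Finset (Fin d → ZMod M) → ((Fin d → ZMod M) → ℝ) → ℂ} {CN : ℝ} (hCN : 0 ≤ CN)
    (hKN : WeakNormLE (abkmNormParams L N Mord R p r₀ h θbar A (schedDelta δ₀ δ₁ N) 𝒞) N KN CN)
    (hKN0 : ∀ φ, KN ∅ φ = 1) (hKNd : ∀ Y, ContDiff ℝ r₀ (KN Y))
    (hKNloc : ∀ Y, IsPolymer (L ^ N) Y → IsConn Y →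
      IsGaugeLocal ((abkmNormParams L N Mord R p r₀ h θbar A (schedDelta δ₀ δ₁ N) 𝒞).gauge N Y) (KN Y)) :
    ∫ φ, pcirc (L ^ N) (fun V => expNegH (0 : RelevantHamiltonian ℂ d) V φ) (fun U => KN U φ) univ
        ∂(tailMeasure 𝒞s N 0) =
      1 + ∫ φ, KN univ φ ∂(stepMeasure (𝒞s (N + 1))) := by
  set P := abkmNormParams L N Mord R p r₀ h θbar A (schedDelta δ₀ δ₁ N) 𝒞 with hP
  have hMo : Odd M := by rw [hM]; exact hLodd.pow
  have hne : (univ : Finset (Fin d → ZMod M)) ≠ ∅ := Finset.univ_nonempty.ne_empty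
  haveI := isProbabilityMeasure_stepMeasure (M := M) (𝒞s (N + 1))
  have htail : tailMeasure 𝒞s N 0 = stepMeasure (𝒞s (N + 1)) := rfl
  rw [htail]
  have hLN : L ^ N = M := hM.symm
  -- integrability of `K_N(Λ, ·)` under `μ_{N+1}` (weak norm on the connected block `Λ`)
  have hΛp : IsPolymer (L ^ N) (univ : Finset (Fin d → ZMod M)) := isPolymer_univ _
  have hΛc : IsConn (univ : Finset (Fin d → ZMod M)) := isConn_top_univ hMo
  have hint0 : Integrable (fun ξ : (Fin d → ZMod M) → ℝ => KN univ ((0 : (Fin d → ZMod M) → ℝ) + ξ))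
      (stepMeasure (𝒞s (N + 1))) :=
    integrable_comp_add_of_weakNormLE_of_stepKernelBounds hB hSN hA hCN hKN hKNd hKNloc hΛp hΛc 0
  have hint : Integrable (fun φ => KN univ φ) (stepMeasure (𝒞s (N + 1))) := by
    refine hint0.congr (ae_of_all _ fun ξ => ?_); simp
  have h := integral_last_scale_zero (d := d) hMo hne (stepMeasure (𝒞s (N + 1))) (K := fun U φ => KN U φ)
    hKN0 hint
  rw [hLN]
  have hcomm : ∀ φ : (Fin d → ZMod M) → ℝ,
      pcirc M (fun V => expNegH (0 : RelevantHamiltonian ℂ d) V φ) (fun U => KN U φ) univ =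
        pcirc M (fun U => KN U φ) (fun V => expNegH (0 : RelevantHamiltonian ℂ d) V φ) univ :=
    fun φ => TorusPolymer.pcirc_comm _ _ (isPolymer_univ M)
  simp_rw [hcomm]
  exact h

end Flow

end Literature.MathematicalPhysics.StatisticalMechanics.GradientRG

end
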